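import Literature.MathematicalPhysics.QuantumFieldTheory.Balaban1983to89.B15StandardRep
import Literature.MathematicalPhysics.QuantumFieldTheory.Balaban1983to89.B15PrelimIntegrations
import Literature.MathematicalPhysics.QuantumFieldTheory.Balaban1983to89.B15BasicStep
import Literature.MathematicalPhysics.QuantumFieldTheory.Balaban1983to89.UnitaryModel
import Literature.MathematicalPhysics.QuantumFieldTheory.Balaban1983to89.MatrixLog

/-!
# `Balaban1983to89.B15SmallField185` — [Balaban1989LargeFieldI] pp. 184–185: *"The inequalities (1.32), (1.39), and
# (1.42) imply that the functions (1.8) in the product in (1.29) are equal to 1. For the functions (1.7) the argument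
# is simpler … (1.43) … The above inequality implies that the functions (1.7) are equal to 1 also."* — PROVED at the
# level of the abstract gauge group from the standard representations (1.35), (1.40)

statement-level skeleton of published theorems with citation tags; proofs where landed; nothing here is a claim about
the Yang–Mills mass gap.

CITATION HEADER (lean-in-tree rule 2026-08-18).  T. Bałaban, *Large field renormalization. I. The basic step of the 𝐑
operation*, Commun. Math. Phys. **122**, 175–202 (1989), doi:10.1007/BF01257412, bib `Balaban1989LargeFieldI` (cell
paper B15; PDF held `paper:balaban1989-cmp122-large-field-i`, journal page = PDF page + 174; pp. 178, 184, 185 READ AS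
IMAGES on the x2 renders `run/shared/lean/pub/pub-balaban/b2b-balaban-ref1/pages/1989-cmp122-large-field-I/…-p004,
p010,p011-x2.png`).  [12] = T. Bałaban, *Averaging operations for lattice gauge theories*, Commun. Math. Phys. **98**,
17–51 (1985) [Balaban1985Averaging], whose (19) p. 21 (*"|UV − 1| ≤ |U − 1| + |V − 1|"*, operator norm) is the field
`GaugeGroup.dist1_mul_le` of `Setup` and whose (24) p. 21 (*"|U − 1| ≤ … ≤ |log U|"*, i.e. `‖e^{iA} − 1‖ ≤ ‖A‖` for
Hermitian `A`) is the tree's `MatrixLog.norm_expUnitary_sub_one_le` — both used BY NAME.  WHAT IS REPRODUCED: SKELETON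
rows `B15.Eq1.32`, `B15.Eq1.39`, `B15.Eq1.42`, `B15.Eq1.43` (and the two p. 185 sentences quoted in the title), unit
`lit-balaban-r12` gen 7 (reader/typer and fold owner of block B15, Phase 2 in own block), HOME
`run/shared/lean/pub/lit-balaban/` (`lit-balaban-r12/ROWS-B15.md`).

THE PRINTED ARGUMENT (pp. 184–185, verbatim).  *"Now we consider the functions (1.7), (1.8). We start with the second,
more difficult case. At first, notice that the restrictions introduced by the functions χ^{(j)}_{□′} in (1.29) imply the
bound |exp ig_jA_j(b)V^{(j)}_{Z_{j+1}∖Z_j}(b)(V^{(j)}_{□′}(b))⁻¹ − 1| < δ_j + |V^{(j)}_{Z_{j+1}∖Z_j}(b) − V^{(j)}_{□′}(b)|.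
(1.32) … This implies V^{(j)}_{Z_{j+1}∖Z_j} = (M̃^j(exp iξℍ)M^j(U_k^{(n+1)}))^{u_j⁻¹} = exp iℍ^{(j)}V_Z^{(j)}, (1.35) …
|exp iℍ^{(j)}(b) − 1| ≤ O(1)L · sup_{B^j(b₋)∪B^j(b₊)} |ℍ|. (1.37) … We assume that it [γ] is so small that the expression
on the left-hand side of (1.37) can be bounded by ½δ_j. From this we obtain |V^{(j)}_{Z_{j+1}∖Z_j}(b) − V^{(j)}_{□′}(b)|
< ½δ_j + |V^{(j)}_{□′}(b) − V^{(j)}_Z(b)|. (1.39) … This representation implies V^{(j)}_{□′} = … = exp iℍ^{(j)}_{□′}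
V_Z^{(j)}, (1.40) … hence |V^{(j)}_{□′}(b) − V^{(j)}_Z(b)| = |exp iℍ^{(j)}_{□′}(b) − 1| < O(1)B₃exp(−δLM₂R_{j+1})22d²(1 +
β₀)(A₀/A₁)δ_j ≤ ½δ_j (1.42) on □′^{∼2}. The inequalities (1.32), (1.39), and (1.42) imply that the functions (1.8) in
the product in (1.29) are equal to 1. For the functions (1.7) the argument is simpler. We have |V_j(b)(V^{(j)}_{□′}(b))⁻¹
− 1| ≤ |V_j(b)(V^{(j)}_Z(b))⁻¹ − 1| + |V^{(j)}_{□′}(b) − V^{(j)}_Z(b)| < 2δ′_j + ½δ_j < 2δ_j on □′^{∼2}, (1.43) for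
□′ ⊂ Ω^{∼2}_{j+1}∖Ω_{j+1}. Here we have used the restrictions from (1.27), and the estimate (1.42). The above inequality
implies that the functions (1.7) are equal to 1 also."*  The functions themselves, p. 178: (1.7) *"χ({sup_{b∈(□′^{∼2})^{(k)*}}
|V_j(b)(V^{(j)}_{□′}(b))⁻¹ − 1| < 2δ_j})"*, (1.8) *"χ({sup_{b∈(□′^{∼2})^{(k)*}} |exp ig_jA_j(b)V^{(j)}_{Z_{j+1}∖Z_j}(b)
(V^{(j)}_{□′}(b))⁻¹ − 1| < 2δ_j})"*, (1.9) (= the `χ^{(j)}_{□′}`) *"χ({sup_{b∈(□′^{∼2})^{(k)*}} |A_j(b)| < g_j⁻¹δ_j})"*,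
(1.27) p. 182 *"χ′_j = χ({|V_j(b)(V^{(j)}_Z(b))⁻¹ − 1| < 2δ′_j …})"*.

WHAT IS TYPED AND PROVED (0 `sorry`, no `def`, no new `Prop`; vocabulary of the tree only: `GaugeGroup`/`dist1`
(`Setup`), the chart datum `B15StandardRep.LieChart` with `expMul` (= *"exp(ig_jA_j)·V"* bondwise) and the averaged
representation `AvgRep`/`Rep135`/`Rep140` (= (1.35)/(1.40)), the characteristic-function predicates
`B15.PrelimIntegrations.SF17` (= (1.7)/(1.8)), `SF19` (= (1.9)), `SF127` (= (1.27)) and the schematic leaves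
`Ineq132`/`Ineq139`/`sf18_of_132_139_142`, `B15.BasicStep.ineq143_iff`).  READING (declared): in the gauge group the
printed distance `|V − W|` of two bond variables is `dist1 (V W⁻¹)` — for unitary matrices in the operator norm this IS
`‖V − W‖` (`norm_sub_eq_dist1`, §6 below), and it is symmetric (`|U⁻¹ − 1| = |U − 1|`, used inside `dist1_mul_inv_triangle`).
* §1–§2 `dist1_mul_mul_inv_le`, `ineq132_le`, `ineq132` — **(1.32)**: `|exp(ig_jA_j(b))V_seam(b)V_{□′}(b)⁻¹ − 1| ≤
  |exp(ig_jA_j(b)) − 1| + |V_seam(b)V_{□′}(b)⁻¹ − 1|` in ANY gauge group ((19) of [12]), hence `< δ_j + …` under the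
  restriction of `χ^{(j)}_{□′}`; `dist1_expI_smul_lt_of_sf19` derives that restriction reading (`|exp(ig_jA_j(b)) − 1| < δ_j`)
  from (1.9) `|A_j(b)| < g_j⁻¹δ_j` and the chart inequality (24) of [12] `|exp(iX) − 1| ≤ ‖X‖` (hypothesis `hchart`, which
  §6 proves for `U(n)`); `ineq132_holds` = the typed leaf `B15.PrelimIntegrations.Ineq132` DISCHARGED for these quantities.
* §3 `dist1_seam_box_le`, `ineq139`, `ineq139_holds` — **(1.39)** from (1.35) (`Rep135`, second member `AvgRep`) and the
  `½δ_j`-bound on the left side of (1.37).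
* §4 `eq142`, `dist1_eq142` — the first member of **(1.42)**, `|V^{(j)}_{□′}(b) − V^{(j)}_Z(b)| = |exp iℍ^{(j)}_{□′}(b) − 1|`,
  from (1.40) (`Rep140`).
* §5 `sf18_of_reps` — **the p. 185 sentence for (1.8)**: under the `χ^{(j)}_{□′}` restriction, (1.35), (1.40) and the two
  `½δ_j` bounds ((1.37) bounded by `½δ_j`; (1.42)), the (1.8)-function `SF17 S δ_j (exp(ig_jA_j)·V_seam) V_{□′}` equals 1;
  `sf18_of_reps'` = the same through the typed leaves `Ineq132`/`Ineq139`/`sf18_of_132_139_142` BY NAME;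
  `ineq143_le`, `ineq143`, `sf17_of_reps` — **(1.43)** and **the p. 185 sentence for (1.7)** from (1.27), (1.40), (1.42)
  and `2δ′_j + ½δ_j < 2δ_j` (⇔ `δ′_j < ¾δ_j`, `B15.BasicStep.ineq143_iff`).
* §6 (model `U(n)`, `UnitaryModel.instGaugeGroupUnitaryGroup`: `dist1 U = ‖U − 1‖_{op}`): `norm_sub_eq_dist1`
  (`‖V − W‖ = dist1 (V W⁻¹)` — the READING above is an identity for unitary matrices), `dist1_expUnitary_le` (the
  hypothesis `hchart` for the exponential chart `X ↦ e^{iX}` on Hermitian `X`, = (24) of [12]).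
NOT reproduced here (inputs kept as hypotheses, as printed): the bounds (1.37)/(1.38) on `ℍ^{(j)}` and the middle
member of (1.42) (exponential decay of the `ℍ`-functions, [12] (106)–(108)/(159)–(163), [14] (1.65)) — they enter as the
two `½δ_j` hypotheses; the smallness of `γ` (p. 185) likewise.

v1.1 (gen 7, append-only §7): the FIRST sentence of the same paragraph, p. 184 — *"Estimating ∂U_{j,□} as in (3.8) [III]
we obtain [(1.31)] … Thus the functions (1.3) in the product on the left-hand side of (1.29) are equal to 1. The same holds
for the functions (1.4)"*: `sf13_of_131` — the (1.3)/(1.4)-function `B15.PrelimIntegrations.SF13` HOLDS for a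
configuration whose plaquette variables obey the first printed inequality of (1.31), by the tree's kernel-checked
arithmetic of the other two (`B15.BasicStep.expr131a_le`, `coeff131_lt_one`, BY NAME).  With `B15Claim184` ((1.5)) the
page's conclusion *"the functions (1.3), (1.4), (1.5), (1.7), (1.8) are equal to 1"* is assembled at this level.

v1.2 (gen 7, append-only §8): (1.38) p. 185, its second and third members as kernel arithmetic — `ineq138_middle`
(`… ≦ B₃(4δ′_j + e^{−δMR_{j+1}}44d²(1+β₀)ε_j)` from the one-step flow relation `ε_{j+1} ≤ (1+2β₀)ε_j`, hypothesis) and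
`eq138_last` (the closing equality `= B₃(4p₁(g_j)/p₀(g_j) + e^{−δMR_{j+1}}44d²(1+β₀)A₀/A₁)δ_j`, EXACT under the letters
`δ′_j = g_jA₁p₁(g_j)`, `ε_j = g_jA₀p₀(g_j)`, `δ_j = g_jA₁p₀(g_j)` of p. 183 / [III] (2.4)); the first member of (1.38)
(the `ℍ`-bound from the boundary-layer fields and the exponential decay) stays an input.

v1.3 (gen 8, append-only §9): p. 181, the `n = 0` instance of (1.29) — *"The restrictions in the function (1.22) imply that
the characteristic functions (1.3) for j = h and □ ⊂ (Ω^∼_{h+1})^c∖Z_h are equal to 1"* (SKELETON row `B15.Claim@181`):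
`claim181_of_transfer` — from (1.22) (`B15.PrelimIntegrations.SF122` on a plaquette set containing that of `□^∼`) and the
(1.30)/(3.6)–(3.8) [III] transfer at `j = h` (the first inequality of (1.31) for `U_{h,□}(V_h)` given the (1.22)-bound on
`U^{(0)}_{k,Z}`, hypothesis — its lattice model is p29's `B14Ineq38Proof.ineq131_first`), the (1.3)-function `SF13` at
`j = h` holds (via `sf13_of_131`); `claim181` — the same as an instance of the typed implication shape
`B15.BasicStep.Claim129` over any family of configurations.
-/

namespace Literature.MathematicalPhysics.QuantumFieldTheory.Balaban1983to89.B15SmallField185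

open B15StandardRep B15.PrelimIntegrations

/-! ## §1. The gauge-group mechanism ((19) of [12]: `|UV − 1| ≤ |U − 1| + |V − 1|`, `|U⁻¹ − 1| = |U − 1|`) -/

section Group

variable {G : Type*} [GaugeGroup G]

/-- The mechanism of **(1.32)** p. 184 in any gauge group: `|E·V·W⁻¹ − 1| ≤ |E − 1| + |V·W⁻¹ − 1|` ((19) of [12]
applied to `E` and `V W⁻¹`). [cite: Balaban1989LargeFieldI, (1.32) p.184] -/
theorem dist1_mul_mul_inv_le (E V W : G) : dist1 (E * V * W⁻¹) ≤ dist1 E + dist1 (V * W⁻¹) := by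
  rw [mul_assoc]
  exact GaugeGroup.dist1_mul_le _ _

/-- A representation `V = X · Z` (the shape of (1.35)/(1.40)/(1.58), `AvgRep`) gives `V Z⁻¹ = X`. [cite: Balaban1989LargeFieldI, (1.42) p.185] -/
theorem mul_inv_eq_of_rep {V X Z : G} (h : V = X * Z) : V * Z⁻¹ = X := by
  rw [h, mul_inv_cancel_right]

/-- The triangle inequality through a third bond variable, in the printed orientation of (1.39)/(1.43):
`|V W⁻¹ − 1| ≤ |V Z⁻¹ − 1| + |W Z⁻¹ − 1|` (`B15.PrelimIntegrations.dist1_fluct_le` + the symmetry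
`|Z W⁻¹ − 1| = |W Z⁻¹ − 1|` of the printed distance, from `|U⁻¹ − 1| = |U − 1|`). [cite: Balaban1989LargeFieldI, (1.43) p.185] -/
theorem dist1_mul_inv_triangle (V W Z : G) : dist1 (V * W⁻¹) ≤ dist1 (V * Z⁻¹) + dist1 (W * Z⁻¹) := by
  -- the printed distance is symmetric: `|Z W⁻¹ − 1| = |(Z W⁻¹)⁻¹ − 1| = |W Z⁻¹ − 1|`
  have hsymm : dist1 (Z * W⁻¹) = dist1 (W * Z⁻¹) := by
    rw [← GaugeGroup.dist1_inv (Z * W⁻¹), mul_inv_rev, inv_inv]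
  rw [← hsymm]
  exact dist1_fluct_le V Z W

end Group

/-! ## §2. (1.32) -/

section Displays

variable {P : Params} {j : ℕ} {G : Type*} [GaugeGroup G] {𝔤 : Type*} (χ : LieChart G 𝔤)

section Normed132

variable [NormedAddCommGroup 𝔤] [NormedSpace ℝ 𝔤]

/-- **(1.32)** p. 184, the inequality behind it, in any gauge group and for any chart: with `E = exp(ig_jA_j(b))`
(`expMul χ g_j A_j V_seam` = the configuration `exp(ig_jA_j)·V^{(j)}_{Z_{j+1}∖Z_j}` tested by (1.8)),
`|E V_seam(b) V_{□′}(b)⁻¹ − 1| ≤ |E − 1| + |V_seam(b) V_{□′}(b)⁻¹ − 1|`. [cite: Balaban1989LargeFieldI, (1.32) p.184] -/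
theorem ineq132_le (gj : ℝ) (Aj : VecField P j 𝔤) (Vseam Vbox : GaugeField P j G) (b : PBond P j) :
    dist1 (expMul χ gj Aj Vseam b * (Vbox b)⁻¹) ≤ dist1 (χ.expI (gj • Aj b)) + dist1 (Vseam b * (Vbox b)⁻¹) :=
  dist1_mul_mul_inv_le (χ.expI (gj • Aj b)) (Vseam b) (Vbox b)

/-- The restriction reading used at (1.32): the `χ^{(j)}_{□′}`-restriction (1.9) `|A_j(b)| < g_j⁻¹δ_j` (`SF19`) and the
chart inequality `|exp(iX) − 1| ≤ ‖X‖` ((24) of [12]; `hchart`, proved for `U(n)` in §6) give `|exp(ig_jA_j(b)) − 1| < δ_j`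
(`g_j > 0`). [cite: Balaban1989LargeFieldI, (1.32) p.184] -/
theorem dist1_expI_smul_lt_of_sf19 (hchart : ∀ X : 𝔤, dist1 (χ.expI X) ≤ ‖X‖) {S : Set (PBond P j)} {gj δj : ℝ}
    (hg : 0 < gj) {Aj : VecField P j 𝔤} (h19 : SF19 S gj δj Aj) {b : PBond P j} (hb : b ∈ S) :
    dist1 (χ.expI (gj • Aj b)) < δj := by
  refine (hchart _).trans_lt ?_
  rw [norm_smul, Real.norm_eq_abs, abs_of_pos hg]
  have hA : ‖Aj b‖ < gj⁻¹ * δj := h19 b hb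
  calc gj * ‖Aj b‖ < gj * (gj⁻¹ * δj) := mul_lt_mul_of_pos_left hA hg
    _ = δj := by field_simp

/-- **(1.32)** p. 184 as printed (strict, with `δ_j`): *"the restrictions introduced by the functions χ^{(j)}_{□′} in (1.29)
imply the bound |exp ig_jA_j(b)V^{(j)}_{Z_{j+1}∖Z_j}(b)(V^{(j)}_{□′}(b))⁻¹ − 1| < δ_j + |V^{(j)}_{Z_{j+1}∖Z_j}(b) − V^{(j)}_{□′}(b)|"*
— from the restriction reading `|exp(ig_jA_j(b)) − 1| < δ_j` (`dist1_expI_smul_lt_of_sf19`). [cite: Balaban1989LargeFieldI, (1.32) p.184] -/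
theorem ineq132 {gj δj : ℝ} {Aj : VecField P j 𝔤} (Vseam Vbox : GaugeField P j G) {b : PBond P j}
    (hE : dist1 (χ.expI (gj • Aj b)) < δj) :
    dist1 (expMul χ gj Aj Vseam b * (Vbox b)⁻¹) < δj + dist1 (Vseam b * (Vbox b)⁻¹) :=
  (ineq132_le χ gj Aj Vseam Vbox b).trans_lt (by linarith)

/-- The typed leaf `B15.PrelimIntegrations.Ineq132 dev8 δ_j diff` DISCHARGED for the group-level quantities:
`dev8 = |exp(ig_jA_j(b))V_seam(b)V_{□′}(b)⁻¹ − 1|`, `diff = |V_seam(b)V_{□′}(b)⁻¹ − 1|`. [cite: Balaban1989LargeFieldI, (1.32) p.184] -/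
theorem ineq132_holds {gj δj : ℝ} {Aj : VecField P j 𝔤} (Vseam Vbox : GaugeField P j G) {b : PBond P j}
    (hE : dist1 (χ.expI (gj • Aj b)) < δj) :
    Ineq132 (dist1 (expMul χ gj Aj Vseam b * (Vbox b)⁻¹)) δj (dist1 (Vseam b * (Vbox b)⁻¹)) :=
  ineq132 χ Vseam Vbox hE

end Normed132

/-! ## §3. (1.39) from (1.35) -/

/-- The mechanism of **(1.39)** p. 185: the averaged representation (1.35) `V^{(j)}_{Z_{j+1}∖Z_j} = exp iℍ^{(j)} V^{(j)}_Z`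
(`AvgRep χ ℍ^{(j)} V_Z V_seam`) gives, for every reference configuration `V_{□′}`,
`|V_seam(b)V_{□′}(b)⁻¹ − 1| ≤ |exp iℍ^{(j)}(b) − 1| + |V_{□′}(b)V_Z(b)⁻¹ − 1|`. [cite: Balaban1989LargeFieldI, (1.39) p.185] -/
theorem dist1_seam_box_le {Hj : VecField P j 𝔤} {VZ Vseam : GaugeField P j G} (h : AvgRep χ Hj VZ Vseam)
    (Vbox : GaugeField P j G) (b : PBond P j) :
    dist1 (Vseam b * (Vbox b)⁻¹) ≤ dist1 (χ.expI (Hj b)) + dist1 (Vbox b * (VZ b)⁻¹) := by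
  have h1 := dist1_mul_inv_triangle (Vseam b) (Vbox b) (VZ b)
  rwa [mul_inv_eq_of_rep (h b)] at h1

/-- **(1.39)** p. 185, verbatim: *"We assume that it is so small that the expression on the left-hand side of (1.37) can
be bounded by ½δ_j. From this we obtain |V^{(j)}_{Z_{j+1}∖Z_j}(b) − V^{(j)}_{□′}(b)| < ½δ_j + |V^{(j)}_{□′}(b) − V^{(j)}_Z(b)|.
(1.39)"* — from (1.35) (`Rep135`, whose second member is the averaged representation) and the bound
`|exp iℍ^{(j)}(b) − 1| < ½δ_j` (the left-hand side of (1.37) bounded by `½δ_j`, strict as the printed `<` requires).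
[cite: Balaban1989LargeFieldI, (1.39) p.185] -/
theorem ineq139 {Mt MjUn1 VZ Vseam : GaugeField P j G} {ujR : GaugeTransf P j G} {Hj : VecField P j 𝔤}
    (h135 : Rep135 χ Mt MjUn1 VZ Vseam ujR Hj) {δj : ℝ} {b : PBond P j}
    (h137 : dist1 (χ.expI (Hj b)) < δj / 2) (Vbox : GaugeField P j G) :
    dist1 (Vseam b * (Vbox b)⁻¹) < δj / 2 + dist1 (Vbox b * (VZ b)⁻¹) := by
  obtain ⟨_, hav⟩ := h135
  have := dist1_seam_box_le χ hav Vbox b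
  linarith

/-- (1.39) with the non-strict reading of *"can be bounded by ½δ_j"* (`≤`), giving `≤`. [cite: Balaban1989LargeFieldI, (1.39) p.185] -/
theorem ineq139_le {Mt MjUn1 VZ Vseam : GaugeField P j G} {ujR : GaugeTransf P j G} {Hj : VecField P j 𝔤}
    (h135 : Rep135 χ Mt MjUn1 VZ Vseam ujR Hj) {δj : ℝ} {b : PBond P j}
    (h137 : dist1 (χ.expI (Hj b)) ≤ δj / 2) (Vbox : GaugeField P j G) :
    dist1 (Vseam b * (Vbox b)⁻¹) ≤ δj / 2 + dist1 (Vbox b * (VZ b)⁻¹) := by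
  obtain ⟨_, hav⟩ := h135
  have := dist1_seam_box_le χ hav Vbox b
  linarith

/-- The typed leaf `B15.PrelimIntegrations.Ineq139 diff δ_j diff′` DISCHARGED for the group-level quantities
(`diff = |V_seam(b)V_{□′}(b)⁻¹ − 1|`, `diff′ = |V_{□′}(b)V_Z(b)⁻¹ − 1|`). [cite: Balaban1989LargeFieldI, (1.39) p.185] -/
theorem ineq139_holds {Mt MjUn1 VZ Vseam : GaugeField P j G} {ujR : GaugeTransf P j G} {Hj : VecField P j 𝔤}
    (h135 : Rep135 χ Mt MjUn1 VZ Vseam ujR Hj) {δj : ℝ} {b : PBond P j}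
    (h137 : dist1 (χ.expI (Hj b)) < δj / 2) (Vbox : GaugeField P j G) :
    Ineq139 (dist1 (Vseam b * (Vbox b)⁻¹)) δj (dist1 (Vbox b * (VZ b)⁻¹)) :=
  ineq139 χ h135 h137 Vbox

/-! ## §4. (1.42), first member, from (1.40) -/

/-- **(1.40) ⇒ (1.42)₁** p. 185: the representation `V^{(j)}_{□′} = exp iℍ^{(j)}_{□′} V^{(j)}_Z` (`Rep140`) gives
`V^{(j)}_{□′}(b) V^{(j)}_Z(b)⁻¹ = exp iℍ^{(j)}_{□′}(b)`. [cite: Balaban1989LargeFieldI, (1.42) p.185] -/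
theorem eq142 {Mt MjUn1 VZ Vbox : GaugeField P j G} {ubR : GaugeTransf P j G} {Hbox : VecField P j 𝔤}
    (h140 : Rep140 χ Mt MjUn1 VZ Vbox ubR Hbox) (b : PBond P j) :
    Vbox b * (VZ b)⁻¹ = χ.expI (Hbox b) := by
  obtain ⟨_, hav⟩ := h140
  exact mul_inv_eq_of_rep (hav b)

/-- **(1.42)**, first member, p. 185, verbatim: *"|V^{(j)}_{□′}(b) − V^{(j)}_Z(b)| = |exp iℍ^{(j)}_{□′}(b) − 1|"*.
[cite: Balaban1989LargeFieldI, (1.42) p.185] -/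
theorem dist1_eq142 {Mt MjUn1 VZ Vbox : GaugeField P j G} {ubR : GaugeTransf P j G} {Hbox : VecField P j 𝔤}
    (h140 : Rep140 χ Mt MjUn1 VZ Vbox ubR Hbox) (b : PBond P j) :
    dist1 (Vbox b * (VZ b)⁻¹) = dist1 (χ.expI (Hbox b)) := by
  rw [eq142 χ h140 b]

/-! ## §5. The p. 185 sentences: the functions (1.8) and (1.7) are equal to 1 -/

section Normed18

variable [NormedAddCommGroup 𝔤] [NormedSpace ℝ 𝔤]

/-- **p. 185:** *"The inequalities (1.32), (1.39), and (1.42) imply that the functions (1.8) in the product in (1.29)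
are equal to 1."*  PROVED: on the bond set `S` of the (1.8)-function, given the `χ^{(j)}_{□′}` restriction reading
`|exp(ig_jA_j(b)) − 1| < δ_j`, the representations (1.35) (`Rep135`) and (1.40) (`Rep140`) over the SAME `V^{(j)}_Z`, and
the two `½δ_j` bounds (`|exp iℍ^{(j)}(b) − 1| ≤ ½δ_j` — (1.37) bounded by `½δ_j`; `|exp iℍ^{(j)}_{□′}(b) − 1| ≤ ½δ_j` —
(1.42)), the tested quantity is `< δ_j + ½δ_j + ½δ_j = 2δ_j`, i.e. `SF17 S δ_j (exp(ig_jA_j)·V_seam) V_{□′}` holds (the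
(1.8)-function equals 1). [cite: Balaban1989LargeFieldI, (1.42) p.185] -/
theorem sf18_of_reps {S : Set (PBond P j)} {gj δj : ℝ} {Aj : VecField P j 𝔤}
    {Mt MjUn1 VZ Vseam : GaugeField P j G} {ujR : GaugeTransf P j G} {Hj : VecField P j 𝔤}
    {Mt' MjUn1' Vbox : GaugeField P j G} {ubR : GaugeTransf P j G} {Hbox : VecField P j 𝔤}
    (hE : ∀ b ∈ S, dist1 (χ.expI (gj • Aj b)) < δj)
    (h135 : Rep135 χ Mt MjUn1 VZ Vseam ujR Hj) (h140 : Rep140 χ Mt' MjUn1' VZ Vbox ubR Hbox)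
    (h137 : ∀ b ∈ S, dist1 (χ.expI (Hj b)) ≤ δj / 2) (h142 : ∀ b ∈ S, dist1 (χ.expI (Hbox b)) ≤ δj / 2) :
    SF17 S δj (expMul χ gj Aj Vseam) Vbox := by
  intro b hb
  have h1 := ineq132_le χ gj Aj Vseam Vbox b
  have h2 := ineq139_le χ h135 (h137 b hb) Vbox
  have h3 := dist1_eq142 χ h140 b
  have h4 := hE b hb
  have h5 := h142 b hb
  linarith

/-- The same conclusion from the printed restriction (1.9) itself (`SF19 S g_j δ_j A_j`, `g_j > 0`) and the chart
inequality (24) of [12] (`hchart`; `U(n)`: §6). [cite: Balaban1989LargeFieldI, (1.42) p.185] -/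
theorem sf18_of_sf19 (hchart : ∀ X : 𝔤, dist1 (χ.expI X) ≤ ‖X‖) {S : Set (PBond P j)} {gj δj : ℝ} (hg : 0 < gj)
    {Aj : VecField P j 𝔤} (h19 : SF19 S gj δj Aj)
    {Mt MjUn1 VZ Vseam : GaugeField P j G} {ujR : GaugeTransf P j G} {Hj : VecField P j 𝔤}
    {Mt' MjUn1' Vbox : GaugeField P j G} {ubR : GaugeTransf P j G} {Hbox : VecField P j 𝔤}
    (h135 : Rep135 χ Mt MjUn1 VZ Vseam ujR Hj) (h140 : Rep140 χ Mt' MjUn1' VZ Vbox ubR Hbox)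
    (h137 : ∀ b ∈ S, dist1 (χ.expI (Hj b)) ≤ δj / 2) (h142 : ∀ b ∈ S, dist1 (χ.expI (Hbox b)) ≤ δj / 2) :
    SF17 S δj (expMul χ gj Aj Vseam) Vbox :=
  sf18_of_reps χ (fun _ hb => dist1_expI_smul_lt_of_sf19 χ hchart hg h19 hb) h135 h140 h137 h142

/-- The p. 185 sentence for (1.8) routed through the typed leaves BY NAME: `Ineq132` (`ineq132_holds`), `Ineq139`
(`ineq139_holds`) and the strict (1.42) feed `B15.PrelimIntegrations.sf18_of_132_139_142`, whose conclusion
`dev8 < 2δ_j` is the (1.8)-function. [cite: Balaban1989LargeFieldI, (1.42) p.185] -/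
theorem sf18_of_reps' {S : Set (PBond P j)} {gj δj : ℝ} {Aj : VecField P j 𝔤}
    {Mt MjUn1 VZ Vseam : GaugeField P j G} {ujR : GaugeTransf P j G} {Hj : VecField P j 𝔤}
    {Mt' MjUn1' Vbox : GaugeField P j G} {ubR : GaugeTransf P j G} {Hbox : VecField P j 𝔤}
    (hE : ∀ b ∈ S, dist1 (χ.expI (gj • Aj b)) < δj)
    (h135 : Rep135 χ Mt MjUn1 VZ Vseam ujR Hj) (h140 : Rep140 χ Mt' MjUn1' VZ Vbox ubR Hbox)
    (h137 : ∀ b ∈ S, dist1 (χ.expI (Hj b)) < δj / 2) (h142 : ∀ b ∈ S, dist1 (χ.expI (Hbox b)) < δj / 2) :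
    SF17 S δj (expMul χ gj Aj Vseam) Vbox := by
  intro b hb
  have h142' : dist1 (Vbox b * (VZ b)⁻¹) < δj / 2 := by
    rw [dist1_eq142 χ h140 b]
    exact h142 b hb
  exact sf18_of_132_139_142 (ineq132_holds χ Vseam Vbox (hE b hb)) (ineq139_holds χ h135 (h137 b hb) Vbox) h142'

end Normed18

/-- **(1.43)** p. 185, first step, verbatim: *"|V_j(b)(V^{(j)}_{□′}(b))⁻¹ − 1| ≤ |V_j(b)(V^{(j)}_Z(b))⁻¹ − 1| +
|V^{(j)}_{□′}(b) − V^{(j)}_Z(b)|"* — in any gauge group, for any three configurations. [cite: Balaban1989LargeFieldI, (1.43) p.185] -/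
theorem ineq143_le (Vj VZ Vbox : GaugeField P j G) (b : PBond P j) :
    dist1 (Vj b * (Vbox b)⁻¹) ≤ dist1 (Vj b * (VZ b)⁻¹) + dist1 (Vbox b * (VZ b)⁻¹) :=
  dist1_mul_inv_triangle (Vj b) (Vbox b) (VZ b)

/-- **(1.43)** p. 185, verbatim: *"… < 2δ′_j + ½δ_j … on □′^{∼2}, for □′ ⊂ Ω^{∼2}_{j+1}∖Ω_{j+1}. Here we have used the
restrictions from (1.27), and the estimate (1.42)."* — on a bond set `S` inside the range `S′` of the (1.27)-restriction
`SF127 S′ δ′_j V_j V^{(j)}_Z`, with (1.40) (`Rep140`) and the strict (1.42) bound `|exp iℍ^{(j)}_{□′}(b) − 1| < ½δ_j`.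
[cite: Balaban1989LargeFieldI, (1.43) p.185] -/
theorem ineq143 {S S' : Set (PBond P j)} (hS : S ⊆ S') {δ'j δj : ℝ} {Vj VZ : GaugeField P j G}
    (h127 : SF127 S' δ'j Vj VZ)
    {Mt MjUn1 Vbox : GaugeField P j G} {ubR : GaugeTransf P j G} {Hbox : VecField P j 𝔤}
    (h140 : Rep140 χ Mt MjUn1 VZ Vbox ubR Hbox) (h142 : ∀ b ∈ S, dist1 (χ.expI (Hbox b)) < δj / 2)
    {b : PBond P j} (hb : b ∈ S) :
    dist1 (Vj b * (Vbox b)⁻¹) < 2 * δ'j + δj / 2 := by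
  have h1 := ineq143_le Vj VZ Vbox b
  have h2 : dist1 (Vj b * (VZ b)⁻¹) < 2 * δ'j := h127 b (hS hb)
  have h3 := dist1_eq142 χ h140 b
  have h4 := h142 b hb
  linarith

/-- **p. 185:** *"… < 2δ′_j + ½δ_j < 2δ_j … The above inequality implies that the functions (1.7) are equal to 1
also."*  PROVED: with (1.27), (1.40), the strict (1.42) bound and `2δ′_j + ½δ_j < 2δ_j` (⇔ `δ′_j < ¾δ_j`,
`B15.BasicStep.ineq143_iff`; true along the flow since `δ′_j/δ_j = (A₁p₁(g_j))/(A₀p₀(g_j))`-type ratios are small,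
p. 183), the (1.7)-function `SF17 S δ_j V_j V^{(j)}_{□′}` holds. [cite: Balaban1989LargeFieldI, (1.43) p.185] -/
theorem sf17_of_reps {S S' : Set (PBond P j)} (hS : S ⊆ S') {δ'j δj : ℝ} {Vj VZ : GaugeField P j G}
    (h127 : SF127 S' δ'j Vj VZ)
    {Mt MjUn1 Vbox : GaugeField P j G} {ubR : GaugeTransf P j G} {Hbox : VecField P j 𝔤}
    (h140 : Rep140 χ Mt MjUn1 VZ Vbox ubR Hbox) (h142 : ∀ b ∈ S, dist1 (χ.expI (Hbox b)) < δj / 2)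
    (hδ : δ'j < 3 / 4 * δj) :
    SF17 S δj Vj Vbox := by
  intro b hb
  have h1 := ineq143 χ hS h127 h140 h142 hb
  have h2 : 2 * δ'j + δj / 2 < 2 * δj := (B15.BasicStep.ineq143_iff δj δ'j).mpr hδ
  linarith

end Displays

/-! ## §6. The unitary matrix model: `|V − W| = dist1 (V W⁻¹)` and the chart inequality (24) of [12] -/

section UnitaryModelDict

open scoped Matrix.Norms.L2Operator

variable {n : Type*} [Fintype n] [DecidableEq n] [Nonempty n]

/-- In `U(n)` with the tree's gauge-group structure (`dist1 U = ‖U − 1‖` in the operator norm, (19) of [12]) the printed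
distance of two bond variables IS the group-level quantity used above: `‖V − W‖ = |V W⁻¹ − 1|` (`V W⁻¹ − 1 = (V − W)W*`
and right multiplication by a unitary is an isometry). [cite: Balaban1985Averaging, (19) p.21] -/
theorem norm_sub_eq_dist1 (V W : Matrix.unitaryGroup n ℂ) :
    ‖(V : Matrix n n ℂ) - (W : Matrix n n ℂ)‖ = dist1 (V * W⁻¹) := by
  have hW : (W : Matrix n n ℂ) * star (W : Matrix n n ℂ) = 1 := Unitary.mul_star_self_of_mem W.2
  have hmem : star (W : Matrix n n ℂ) ∈ unitary (Matrix n n ℂ) := Unitary.star_mem W.2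
  have h1 : ((V * W⁻¹ : Matrix.unitaryGroup n ℂ) : Matrix n n ℂ) - 1
      = ((V : Matrix n n ℂ) - W) * star (W : Matrix n n ℂ) := by
    rw [sub_mul, hW]
    simp
  show _ = UnitaryModel.opDist1 ((V * W⁻¹ : Matrix.unitaryGroup n ℂ) : Matrix n n ℂ)
  rw [UnitaryModel.opDist1, h1, CStarRing.norm_mul_mem_unitary _ hmem]

/-- **(24) of [12]** for the model — the hypothesis `hchart` of `dist1_expI_smul_lt_of_sf19`/`sf18_of_sf19` holds for the
exponential chart `X ↦ e^{iX}` of `U(n)` on Hermitian `X` (`selfAdjoint.expUnitary`): `|e^{iX} − 1| ≤ ‖X‖`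
(`MatrixLog.norm_expUnitary_sub_one_le`). [cite: Balaban1985Averaging, (24) p.21] -/
theorem dist1_expUnitary_le (X : selfAdjoint (Matrix n n ℂ)) :
    dist1 (selfAdjoint.expUnitary X : Matrix.unitaryGroup n ℂ) ≤ ‖X‖ := by
  letI : CStarAlgebra (Matrix n n ℂ) := {}
  exact MatrixLog.norm_expUnitary_sub_one_le (A := Matrix n n ℂ) X

end UnitaryModelDict

/-! ## §7 (v1.1). p. 184: (1.31) ⇒ the functions (1.3), (1.4) are equal to 1 -/

section Functions13

variable {P : Params} {i : ℕ} {G : Type*} [GaugeGroup G]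

/-- **p. 184** [PDF 10], verbatim: *"Estimating ∂U_{j,□} as in (3.8) [III] we obtain |U_{j,□}(∂p) − 1| < (1 +
(2β/10)ε_jξ)(1 − β½)ε_jξ² + (2β/10)ε_jξ²(1 + (4β/10)ε_j) < (1 − β/2 + (2β/10)L⁻² + 4β/10)ε_jξ² < ε_j(L^{k−j}η)² for
p ⊂ □^∼. (1.31)  Thus the functions (1.3) in the product on the left-hand side of (1.29) are equal to 1. The same holds
for the functions (1.4), because the argument above applies to an arbitrary j"*.  PROVED: if the plaquette variables of
the configuration `U` (= `U_{j,□}(V_j)`) on the plaquette set `S` (= the plaquettes of `□^∼`) obey the FIRST printed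
inequality of (1.31) (the (3.6)–(3.8) [III] + (1.65) [14] estimate, hypothesis `h131`, `B15.BasicStep.expr131a`), then by
the kernel-checked middle and last inequalities (`B15.BasicStep.expr131a_le` under the implicit smallness `ε_jξ ≤ L⁻²`,
`0 ≤ β ≤ 1`, `0 ≤ ε_j ≤ 1`; `coeff131_lt_one` for `β > 0`, `L ≥ 2`) the (1.3)-function `SF13 S ε_j L^{k−j} η U` holds
(`ξ = L^{k−j}η`). [cite: Balaban1989LargeFieldI, (1.31) p.184] -/
theorem sf13_of_131 {S : Set (Plaq P i)} {β εj Lpow η L : ℝ} {U : GaugeField P i G}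
    (h131 : ∀ p ∈ S, dist1 (GaugeField.plaqHol U p) < B15.BasicStep.expr131a β εj (Lpow * η))
    (hβ0 : 0 < β) (hβ1 : β ≤ 1) (hε0 : 0 ≤ εj) (hε1 : εj ≤ 1) (hξ : 0 ≤ Lpow * η)
    (hεξ : εj * (Lpow * η) ≤ (L ^ 2)⁻¹) (hL : 2 ≤ L) :
    SF13 S εj Lpow η U := by
  intro p hp
  have h1 := h131 p hp
  have h2 := B15.BasicStep.expr131a_le hβ0.le hβ1 hε0 hε1 hξ hεξ
  have h3 := B15.BasicStep.coeff131_lt_one hβ0 hL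
  have hx : 0 ≤ εj * (Lpow * η) ^ 2 := by positivity
  have h4 : B15.BasicStep.coeff131 β L * (εj * (Lpow * η) ^ 2) ≤ 1 * (εj * (Lpow * η) ^ 2) :=
    mul_le_mul_of_nonneg_right h3.le hx
  linarith

end Functions13

/-! ## §8 (v1.2, gen 7). (1.38) p. 185: the second and third members (arithmetic of the printed chain) -/

section Ineq138

/-- **(1.38) p. 185 [PDF 11], MIDDLE MEMBER**, verbatim chain: *"|ℍ| < B₃(4δ′_j + exp(−δMR_{j+1})22d²ε_{j+1} +
exp(−δ6LMR_{j+1})22d²ε_j) ≦ B₃(4δ′_j + exp(−δMR_{j+1})44d²(1 + β₀)ε_j)"* — PROVED as arithmetic from the one-step flow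
relation `ε_{j+1} ≤ (1 + 2β₀)ε_j` (hypothesis; [III] (2.5)–(2.8) give the slow growth of `ε_j` backwards in `j`; with
exactly this factor the printed `44d²(1 + β₀)` is sharp: `22(1 + 2β₀) + 22 = 44(1 + β₀)`; READING REMARK: the coarse
cumulative relation [III] (2.8) alone, `ε_{j+1} ≤ 2(1 + β₀)ε_j`, would only give `22d²(3 + 2β₀)` here — the printed
coefficient uses the one-step closeness of consecutive `ε`'s, which [III] (2.5)/(2.7) provide), `6L ≥ 1`, `δMR_{j+1} ≥ 0`,
`B₃ ≥ 0`, `ε_j ≥ 0` (the term `e^{−δ6LMR_{j+1}}` is bounded by `e^{−δMR_{j+1}}`).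
[cite: Balaban1989LargeFieldI, (1.38) p.185] -/
theorem ineq138_middle {B₃ δ' a L d εj εj1 β₀ : ℝ} (hB₃ : 0 ≤ B₃) (ha : 0 ≤ a) (hL : 1 ≤ 6 * L) (hεj : 0 ≤ εj)
    (hflow : εj1 ≤ (1 + 2 * β₀) * εj) :
    B₃ * (4 * δ' + Real.exp (-a) * (22 * d ^ 2) * εj1 + Real.exp (-(6 * L * a)) * (22 * d ^ 2) * εj)
      ≤ B₃ * (4 * δ' + Real.exp (-a) * (44 * d ^ 2) * (1 + β₀) * εj) := by
  have h1 : Real.exp (-(6 * L * a)) ≤ Real.exp (-a) := Real.exp_le_exp.mpr (by nlinarith)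
  have he : 0 ≤ Real.exp (-a) := (Real.exp_pos _).le
  have hd : 0 ≤ 22 * d ^ 2 := by positivity
  have h2 : Real.exp (-a) * (22 * d ^ 2) * εj1 ≤ Real.exp (-a) * (22 * d ^ 2) * ((1 + 2 * β₀) * εj) :=
    mul_le_mul_of_nonneg_left hflow (mul_nonneg he hd)
  have h3 : Real.exp (-(6 * L * a)) * (22 * d ^ 2) * εj ≤ Real.exp (-a) * (22 * d ^ 2) * εj :=
    mul_le_mul_of_nonneg_right (mul_le_mul_of_nonneg_right h1 hd) hεj
  refine mul_le_mul_of_nonneg_left ?_ hB₃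
  nlinarith [mul_nonneg (mul_nonneg he hd) hεj]

/-- **(1.38), LAST MEMBER (the equality)**, verbatim: *"= B₃(4 p₁(g_j)/p₀(g_j) + exp(−δMR_{j+1})44d²(1 + β₀) A₀/A₁) δ_j"*
— PROVED as the exact identity it is under the letters of p. 183 / [III] (2.4): `δ′_j = g_jA₁p₁(g_j)` ((1.27)),
`ε_j = g_jA₀p₀(g_j)`, `δ_j = g_jA₁p₀(g_j)` (`A₁, p₀(g_j) ≠ 0`).  Reading remark: the text continues *"The quotient on
the right-hand side of the last equality is a negative power of log g_j⁻², hence the coefficient at δ_j can be arbitrarily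
small"* — `p₁(g)/p₀(g) = (log g⁻²)^{p₁−p₀}`, `p₁ < p₀`. [cite: Balaban1989LargeFieldI, (1.38) p.185] -/
theorem eq138_last {B₃ a d β₀ g A₀ A₁ p₀ p₁ δ' εj δj : ℝ} (hA₁ : A₁ ≠ 0) (hp₀ : p₀ ≠ 0)
    (hδ' : δ' = g * A₁ * p₁) (hε : εj = g * A₀ * p₀) (hδ : δj = g * A₁ * p₀) :
    B₃ * (4 * δ' + Real.exp (-a) * (44 * d ^ 2) * (1 + β₀) * εj)
      = B₃ * (4 * (p₁ / p₀) + Real.exp (-a) * (44 * d ^ 2) * (1 + β₀) * (A₀ / A₁)) * δj := by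
  subst hδ' hε hδ
  field_simp

end Ineq138

/-! ## §9 (v1.3, gen 8). p. 181: (1.22) ⇒ the functions (1.3) for `j = h` are equal to 1 (row `B15.Claim@181`) -/

section Claim181

variable {P : Params} {i : ℕ} {G : Type*} [GaugeGroup G]

/-- **p. 181** [PDF 7], verbatim: *"The restrictions in the function (1.22) imply that the characteristic functions (1.3)
for j = h and □ ⊂ (Ω^∼_{h+1})^c∖Z_h are equal to 1. Thus the function χ_h(Ω_h∖Ω^∼_{h+1}) in (1.2) is replaced by
χ_k^{(0)}χ_h(Z_h∩Ω_h)."* — the `n = 0` instance of the mechanism of (1.29)–(1.31): if `U^{(0)}_{k,Z}` (= `U0`) satisfies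
(1.22) on the plaquettes `S₀` of `Ω_h∖Ω_{h+1}` (`SF122 S₀ β ε_h L^{k−h} η U0`), the plaquettes `S` of `□^∼` lie in `S₀`,
and the representation (1.30) with the estimate *"as in (3.8) [III]"* transfers the (1.22)-bound on `U0` to the first
inequality of (1.31) for `U = U_{h,□}(V_h)` on `S` (hypothesis `htransfer`; its ℤᵈ lattice model is
`B14Ineq38Proof.ineq131_first`), then the (1.3)-function `SF13 S ε_h L^{k−h} η U` holds — under the side conditions of
`sf13_of_131` (`0 < β ≦ 1`, `0 ≦ ε_h ≦ 1`, `ε_hξ ≦ L⁻²`, `L ≧ 2`, `ξ = L^{k−h}η ≧ 0`). [cite: Balaban1989LargeFieldI, (1.22) p.181] -/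
theorem claim181_of_transfer {S S₀ : Set (Plaq P i)} (hS : S ⊆ S₀) {β εh Lpow η L : ℝ} {U0 U : GaugeField P i G}
    (h122 : SF122 S₀ β εh Lpow η U0)
    (htransfer : (∀ p ∈ S, dist1 (GaugeField.plaqHol U0 p) < (1 - β / 2) * εh * (Lpow * η) ^ 2) →
      ∀ p ∈ S, dist1 (GaugeField.plaqHol U p) < B15.BasicStep.expr131a β εh (Lpow * η))
    (hβ0 : 0 < β) (hβ1 : β ≤ 1) (hε0 : 0 ≤ εh) (hε1 : εh ≤ 1) (hξ : 0 ≤ Lpow * η)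
    (hεξ : εh * (Lpow * η) ≤ (L ^ 2)⁻¹) (hL : 2 ≤ L) :
    SF13 S εh Lpow η U := by
  have h0 : ∀ p ∈ S, dist1 (GaugeField.plaqHol U0 p) < (1 - β / 2) * εh * (Lpow * η) ^ 2 :=
    fun p hp => h122 p (hS hp)
  exact sf13_of_131 (htransfer h0) hβ0 hβ1 hε0 hε1 hξ hεξ hL

/-- **Row `B15.Claim@181` as an instance of the typed implication shape (1.29)** (`B15.BasicStep.Claim129 new old`):
over any family of configurations `c` (background `U0 c` = `U^{(0)}_{k,Z}`, small-field background `U c` = `U_{h,□}(V_h)`),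
`new c` := the (1.22)-restriction and `old c` := the (1.3)-function at `j = h`; the transfer hypothesis as in
`claim181_of_transfer`, uniformly in `c`. [cite: Balaban1989LargeFieldI, (1.22) p.181] -/
theorem claim181 {C : Type*} {S S₀ : Set (Plaq P i)} (hS : S ⊆ S₀) {β εh Lpow η L : ℝ}
    (U0 U : C → GaugeField P i G)
    (htransfer : ∀ c, (∀ p ∈ S, dist1 (GaugeField.plaqHol (U0 c) p) < (1 - β / 2) * εh * (Lpow * η) ^ 2) →
      ∀ p ∈ S, dist1 (GaugeField.plaqHol (U c) p) < B15.BasicStep.expr131a β εh (Lpow * η))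
    (hβ0 : 0 < β) (hβ1 : β ≤ 1) (hε0 : 0 ≤ εh) (hε1 : εh ≤ 1) (hξ : 0 ≤ Lpow * η)
    (hεξ : εh * (Lpow * η) ≤ (L ^ 2)⁻¹) (hL : 2 ≤ L) :
    B15.BasicStep.Claim129 (fun c => SF122 S₀ β εh Lpow η (U0 c)) (fun c => SF13 S εh Lpow η (U c)) :=
  fun c h122 => claim181_of_transfer hS h122 (htransfer c) hβ0 hβ1 hε0 hε1 hξ hεξ hL

end Claim181

end Literature.MathematicalPhysics.QuantumFieldTheory.Balaban1983to89.B15SmallField185
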